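import Literature.Geometry.Kaehler.HolomorphicChainBoundary
import Literature.Geometry.Kaehler.IrreducibleComponentsFiniteProofs
import Literature.Geometry.Kaehler.IrreducibleComponentsDecompositionProofs
import HarnessLib

/-!
# The holomorphic chain `[A]` of a pure-dimensional analytic set

For the monotonicity of the mass ratio of an analytic SET `A` of pure dimension `p`
(`Literature.Geometry.Kaehler.Chirka1989_massRatio_monotoneOn`, [Chirka1989, §15.1 Prop. 1]) the
closed-current machinery of the tree (`HolomorphicChain.toCurrent`, `d[T] = 0`:
`Harvey1977_boundary_toCurrent_eq_zero_holds`) has to be applied to the current `[A]` of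
integration over `reg A` [Chirka1989, §14.1 Cor., §14.2 Prop. 3]. This file realises `[A]` as the
holomorphic `p`-chain `HolomorphicChain.ofSet A = Σ_j 1 · [Aⱼ]` over the irreducible components
`Aⱼ` of `A` (Chirka: an analytic set "is a holomorphic chain with all multiplicities `1`",
§11.5), and identifies its data:

* `IsIrreducibleComponent.hasPureCodim` / `.hasPureDim` — **the irreducible components of a set
  of pure dimension `p` have pure dimension `p`** (a component is `cl S` for a connected
  component `S` of `reg A`, and `A` agrees with `cl S` near the points of `S`)
  [Chirka1989, §5.4 Thm., §5.3 Cor.];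
* `IsIrreducibleComponent.eq_of_mem_regularLocus` — a regular point of `A` lies on exactly ONE
  irreducible component [Chirka1989, §5.4 Thm. (1)];
* `HolomorphicChain.ofSet` and `support_ofSet : |[A]| = A`, `carrier_ofSet : carrier = reg A`,
  `density_ofSet_of_mem_carrier : θ = 1` on the carrier (not only a.e.),
  `measure_image_inter_eq_carrier_inter : 𝓗^{2p}(A ∩ S) = 𝓗^{2p}(reg A ∩ S)` (`sng A` is
  `𝓗^{2p}`-null, [Chirka1989, §14.1]),
  `exists_orientationFrame_eq_complexFrame` — the orientation frame is the real frame of a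
  unitary frame at every carrier point;
* `setIntegral_extDeriv_apply_orientationFrame_eq_zero` — **`∫_{reg A} dψ(ξ_A) d𝓗^{2p} = 0`**
  for every test `(2p-1)`-form `ψ`: "the current given by integration over `A` is `d`-closed"
  [Chirka1989, §14.2 Prop. 3], here from `Harvey1977_boundary_toCurrent_eq_zero_holds`.

Everything is proved; the deep inputs are the discharged §5.4 facts of
`IrreducibleComponents*.lean` and the `d`-closedness of holomorphic chains.

## References

* E. M. Chirka, *Complex Analytic Sets*, Kluwer 1989, §5.3–5.4 (irreducible components), §11.5
  (holomorphic chains), §14.1–14.2 (the current `[A]`, `d[A] = 0`) [Chirka1989].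
* R. Harvey, *Holomorphic chains and their boundaries*, PSPUM XXX.1 (1977), Lemma 1.8 [Harvey1977].
-/

open scoped Manifold Topology ENNReal
open Set Filter MeasureTheory

namespace Literature.Geometry.Kaehler

/-! ### A regular point lies on exactly one irreducible component -/

section Components

variable {E : Type*} [NormedAddCommGroup E] [NormedSpace ℂ E]
  {H : Type*} [TopologicalSpace H] {I : ModelWithCorners ℂ E H}
  {M : Type*} [TopologicalSpace M] [ChartedSpace H M] [FiniteDimensional ℂ E]

variable [IsManifold I 1 M] [I.Boundaryless]

/-- **A regular point determines its component**: an irreducible component `Z'` of the analytic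
set `Z` containing a regular point `y` of `Z` is the closure of the connected component of `y` in
`reg Z` (`Z'` is `cl S'` for some component `S'` of `reg Z`, and `S'` meets the trace of `Z` near
`y`, which lies in the component of `y`). [cite: Chirka1989, §5.4 Thm. (1), p. 57] -/
theorem IsIrreducibleComponent.eq_closure_connectedComponentIn_of_mem {Z Z' : Set M}
    (hZ : IsAnalyticSet I Z) (h : IsIrreducibleComponent I Z Z') {y : M}
    (hy : y ∈ regularLocus I Z) (hyZ' : y ∈ Z') :
    Z' = closure (connectedComponentIn (regularLocus I Z) y) := by
  obtain ⟨y', -, rfl⟩ :=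
    IsIrreducibleComponent.exists_eq_closure_connectedComponentIn_holds I M hZ h
  obtain ⟨N, hNo, hyN, hN⟩ :=
    exists_isOpen_inter_subset_connectedComponentIn (mem_connectedComponentIn hy)
  obtain ⟨z, hzN, hz⟩ := mem_closure_iff.1 hyZ' N hNo hyN
  have hzcc : z ∈ connectedComponentIn (regularLocus I Z) y :=
    hN ⟨(connectedComponentIn_subset _ _ hz).1, hzN⟩
  rw [connectedComponentIn_eq hz, ← connectedComponentIn_eq hzcc]

/-- **A regular point of `Z` lies on exactly one irreducible component of `Z`.**
[cite: Chirka1989, §5.4 Thm. (1), p. 57] -/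
theorem IsIrreducibleComponent.eq_of_mem_regularLocus {Z Z₁ Z₂ : Set M} (hZ : IsAnalyticSet I Z)
    (h₁ : IsIrreducibleComponent I Z Z₁) (h₂ : IsIrreducibleComponent I Z Z₂) {y : M}
    (hy : y ∈ regularLocus I Z) (hy₁ : y ∈ Z₁) (hy₂ : y ∈ Z₂) : Z₁ = Z₂ := by
  rw [h₁.eq_closure_connectedComponentIn_of_mem hZ hy hy₁,
    h₂.eq_closure_connectedComponentIn_of_mem hZ hy hy₂]

/-- The closure of the connected component of a regular point in `reg Z` is an irreducible
component of `Z` (the discharged §5.4 Lemma, restated). [cite: Chirka1989, §5.4 Lemma, p. 56] -/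
theorem isIrreducibleComponent_closure_connectedComponentIn {Z : Set M} (hZ : IsAnalyticSet I Z)
    {y : M} (hy : y ∈ regularLocus I Z) :
    IsIrreducibleComponent I Z (closure (connectedComponentIn (regularLocus I Z) y)) :=
  IsAnalyticSet.isIrreducibleComponent_closure_connectedComponentIn_holds I M hZ hy

/-- **Irreducible components of a set of pure codimension `c` have pure codimension `c`**: a
component `Z' = cl S` has SOME pure codimension `c'` (irreducible sets are pure dimensional,
§5.3 Cor.), and at a point `y ∈ S` the sets `Z` and `Z'` agree near `y`, so `y` is regular of
codimension `c` in `Z'` as well, whence `c' = c`. [cite: Chirka1989, §5.3 Cor. and §5.4 Thm.] -/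
theorem IsIrreducibleComponent.hasPureCodim {Z Z' : Set M} {c : ℕ} (hZ : HasPureCodim I Z c)
    (h : IsIrreducibleComponent I Z Z') : HasPureCodim I Z' c := by
  obtain ⟨c', hc'⟩ := IsIrreducibleAnalyticSet.exists_hasPureCodim_holds I M h.isIrreducibleAnalyticSet
  obtain ⟨y, hy, hZ'eq⟩ :=
    IsIrreducibleComponent.exists_eq_closure_connectedComponentIn_holds I M hZ.1 h
  have hyZ' : y ∈ Z' := hZ'eq ▸ subset_closure (mem_connectedComponentIn hy)
  obtain ⟨N, hNo, hyN, hN⟩ :=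
    exists_isOpen_inter_subset_connectedComponentIn (mem_connectedComponentIn hy)
  have hZZ' : Z ∩ N = Z' ∩ N := by
    refine Subset.antisymm (fun z hz => ⟨?_, hz.2⟩) fun z hz => ⟨h.subset hz.1, hz.2⟩
    rw [hZ'eq]
    exact subset_closure (hN hz)
  have hyc : IsRegularPointOfCodim I Z' c y := (hZ.2.2 y hy).congr_set hNo hyN hZZ'
  have hyc' : IsRegularPointOfCodim I Z' c' y := hc'.2.2 y ⟨hyZ', c, hyc⟩
  obtain rfl : c = c' := hyc.codim_unique hyZ' hyc'
  exact hc'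

/-- Irreducible components of a set of pure dimension `p` have pure dimension `p`.
[cite: Chirka1989, §5.3 Cor. and §5.4 Thm.] -/
theorem IsIrreducibleComponent.hasPureDim {Z Z' : Set M} {p : ℕ} (hZ : HasPureDim I Z p)
    (h : IsIrreducibleComponent I Z Z') : HasPureDim I Z' p := by
  obtain ⟨c, hpc, hc⟩ := hZ
  exact ⟨c, hpc, h.hasPureCodim hc⟩

end Components

/-! ### The chain `[A]` of a pure-dimensional analytic set -/

namespace HolomorphicChain

section OfSet

variable {E : Type*} [NormedAddCommGroup E] [NormedSpace ℂ E]
  {H : Type*} [TopologicalSpace H] {I : ModelWithCorners ℂ E H}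
  {M : Type*} [TopologicalSpace M] [ChartedSpace H M] [FiniteDimensional ℂ E]
  [IsManifold I 1 M] [I.Boundaryless] {p : ℕ}

open scoped Classical in
/-- **The holomorphic `p`-chain `[A] = Σⱼ 1 · [Aⱼ]` of an analytic set `A` of pure dimension `p`**:
multiplicity `1` on each irreducible component `Aⱼ` of `A` and `0` elsewhere (the components are
irreducible of pure dimension `p`, and locally finite by §5.4 Thm. (3)). Its current
`[A](φ) = ∫_{reg A} φ` is Chirka's current of integration over `A` (§14.1 Cor.); "analytic sets
are holomorphic chains with all multiplicities `1`". [cite: Chirka1989, §11.5 and §14.1 Cor.] -/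
noncomputable def ofSet (A : Set M) (hA : HasPureDim I A p) : HolomorphicChain I M p where
  mult Z := if IsIrreducibleComponent I A Z then 1 else 0
  isIrreducibleAnalyticSet_of_mult_ne_zero Z h := by
    by_cases hZ : IsIrreducibleComponent I A Z
    · exact hZ.isIrreducibleAnalyticSet
    · exact absurd (if_neg hZ) h
  hasPureDim_of_mult_ne_zero Z h := by
    by_cases hZ : IsIrreducibleComponent I A Z
    · exact hZ.hasPureDim hA
    · exact absurd (if_neg hZ) h
  finite_inter_compact K hK := by
    refine (IsAnalyticSet.finite_isIrreducibleComponent_inter_compact_holds I M hA.isAnalyticSet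
      hK).subset ?_
    rintro Z ⟨h, hKZ⟩
    by_cases hZ : IsIrreducibleComponent I A Z
    · exact ⟨hZ, hKZ⟩
    · exact absurd (if_neg hZ) h

open scoped Classical in
/-- The multiplicities of `[A]`. [folklore] -/
theorem mult_ofSet (A : Set M) (hA : HasPureDim I A p) (Z : Set M) :
    (ofSet A hA).mult Z = if IsIrreducibleComponent I A Z then 1 else 0 := rfl

/-- The components of the chain `[A]` are exactly the irreducible components of `A`. [folklore] -/
theorem mult_ofSet_ne_zero_iff {A : Set M} (hA : HasPureDim I A p) {Z : Set M} :
    (ofSet A hA).mult Z ≠ 0 ↔ IsIrreducibleComponent I A Z := by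
  classical
  rw [mult_ofSet]
  split_ifs with h <;> simp [h]

/-- **`|[A]| = A`**: every point of `A` lies on an irreducible component (§5.4 Thm. (2) with the
Lemma), and components lie in `A`. [cite: Chirka1989, §5.4 Thm., p. 57] -/
theorem support_ofSet {A : Set M} (hA : HasPureDim I A p) : (ofSet A hA).support = A := by
  apply Subset.antisymm
  · intro x hx
    obtain ⟨Z, hZ, hxZ⟩ := mem_support_iff.1 hx
    exact ((mult_ofSet_ne_zero_iff hA).1 hZ).subset hxZ
  · intro x hx
    obtain ⟨Z, hZ, hxZ⟩ := IsAnalyticSet.exists_isIrreducibleComponent_of_mem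
      (@IsAnalyticSet.eq_iUnion_closure_connectedComponentIn_holds _ _ _ _ _ I M _ _)
      (@IsAnalyticSet.isIrreducibleComponent_closure_connectedComponentIn_holds _ _ _ _ _ I M _ _)
      hA.isAnalyticSet hx
    exact mem_support_iff.2 ⟨Z, (mult_ofSet_ne_zero_iff hA).2 hZ, hxZ⟩

/-- **The density of `[A]` is `1` at every regular point of `A`** (a regular point lies on exactly
one component). [cite: Chirka1989, §5.4 Thm. (1) and §14.1 Cor.] -/
theorem multAt_ofSet_of_mem_regularLocus {A : Set M} (hA : HasPureDim I A p) {y : M}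
    (hy : y ∈ regularLocus I A) : (ofSet A hA).multAt y = 1 := by
  have hZ₀ := isIrreducibleComponent_closure_connectedComponentIn hA.isAnalyticSet hy
  have hyZ₀ : y ∈ closure (connectedComponentIn (regularLocus I A) y) :=
    subset_closure (mem_connectedComponentIn hy)
  rw [multAt_eq_mult hyZ₀, mult_ofSet, if_pos hZ₀]
  intro Z' hZ' hyZ'
  exact ((mult_ofSet_ne_zero_iff hA).1 hZ').eq_closure_connectedComponentIn_of_mem
    hA.isAnalyticSet hy hyZ'

end OfSet

section Opens

open Literature.Geometry.GeometricMeasureTheory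

-- Nested operator-norm instances on `Covector V m`, as in `Currents.lean`.
set_option maxSynthPendingDepth 2

variable {V : Type*} [NormedAddCommGroup V] [InnerProductSpace ℂ V] [FiniteDimensional ℂ V]
  {Ω : TopologicalSpace.Opens V} {p : ℕ}

/-- The carrier of `[A]` is (the image in `V` of) `reg A`. [cite: Chirka1989, §14.1 Cor.] -/
theorem carrier_ofSet {A : Set Ω} (hA : HasPureDim 𝓘(ℂ, V) A p) :
    (ofSet A hA).carrier = ((↑) : Ω → V) '' regularLocus 𝓘(ℂ, V) A := by
  rw [carrier, support_ofSet]

/-- The density of `[A]` is `1` on its carrier. [cite: Chirka1989, §14.1 Cor.] -/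
theorem density_ofSet_of_mem_carrier {A : Set Ω} (hA : HasPureDim 𝓘(ℂ, V) A p) {x : V}
    (hx : x ∈ (ofSet A hA).carrier) : (ofSet A hA).density x = 1 := by
  rw [carrier_ofSet] at hx
  obtain ⟨y, hy, rfl⟩ := hx
  rw [density_apply_coe, multAt_ofSet_of_mem_regularLocus hA hy]

variable [MeasurableSpace V] [BorelSpace V]

/-- **`𝓗^{2p}(A ∩ S) = 𝓗^{2p}(reg A ∩ S)`** for every `S`: the singular locus of a set of pure
dimension `p` is `𝓗^{2p}`-null (`dim sng A ≤ p - 1`). [cite: Chirka1989, §14.1, p. 174] -/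
theorem measure_image_inter_eq_carrier_inter {A : Set Ω} (hA : HasPureDim 𝓘(ℂ, V) A p) (S : Set V) :
    (μHE[2 * p] : Measure V) (((↑) : Ω → V) '' A ∩ S) =
      (μHE[2 * p] : Measure V) ((ofSet A hA).carrier ∩ S) := by
  obtain ⟨c, hpc, hc⟩ := hA
  have hnull : (μHE[2 * p] : Measure V) (((↑) : Ω → V) '' singularLocus 𝓘(ℂ, V) A) = 0 :=
    hc.euclideanHausdorffMeasure_image_singularLocus_eq_zero hpc
  rw [carrier_ofSet]
  have hsplit : ((↑) : Ω → V) '' A ∩ S =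
      ((↑) : Ω → V) '' regularLocus 𝓘(ℂ, V) A ∩ S ∪ ((↑) : Ω → V) '' singularLocus 𝓘(ℂ, V) A ∩ S := by
    rw [← union_inter_distrib_right, ← image_union, regularLocus_union_singularLocus]
  rw [hsplit]
  apply le_antisymm
  · calc (μHE[2 * p] : Measure V) (((↑) : Ω → V) '' regularLocus 𝓘(ℂ, V) A ∩ S ∪
          ((↑) : Ω → V) '' singularLocus 𝓘(ℂ, V) A ∩ S)
        ≤ (μHE[2 * p] : Measure V) (((↑) : Ω → V) '' regularLocus 𝓘(ℂ, V) A ∩ S) +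
          (μHE[2 * p] : Measure V) (((↑) : Ω → V) '' singularLocus 𝓘(ℂ, V) A ∩ S) :=
          measure_union_le _ _
      _ = (μHE[2 * p] : Measure V) (((↑) : Ω → V) '' regularLocus 𝓘(ℂ, V) A ∩ S) := by
          rw [measure_mono_null inter_subset_left hnull, add_zero]
  · exact measure_mono subset_union_left

/-- At every point of the carrier of a holomorphic chain the orientation frame IS the real frame
`(u₀, I u₀, …)` of a unitary `p`-frame `u` (the `dif` branch of `HolomorphicChain.orientationFrame`
holds there, `exists_orthonormal_span_eq_approxTangentCone`). [cite: Chirka1989, §14.1, p. 174] -/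
theorem exists_orientationFrame_eq_complexFrame (T : HolomorphicChain 𝓘(ℂ, V) Ω p) {v : V}
    (hv : v ∈ T.carrier) :
    ∃ u : Fin p → V, Orthonormal ℂ u ∧ T.orientationFrame v = complexFrame u := by
  classical
  have h := T.exists_orthonormal_span_eq_approxTangentCone hv
  refine ⟨h.choose, h.choose_spec.1, ?_⟩
  unfold HolomorphicChain.orientationFrame
  rw [dif_pos h]

/-- **`[A]` is `d`-closed, integral form**: for an analytic set `A ⊆ Ω` of pure dimension
`q + 1` and every test `(2q+1)`-form `ψ` on `Ω`, `∫_{reg A} dψ(ξ_A) d𝓗^{2q+2} = 0` — "the current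
given by integration over `A` is `d`-closed, i.e. `∫_A dφ = 0`"; from `d[T] = 0` for the chain
`T = [A]` (`Harvey1977_boundary_toCurrent_eq_zero_holds`), the integral formula for `d[T]`
(`boundary_apply_eq_setIntegral`) and `θ = 1` on the carrier.
[cite: Chirka1989, §14.2 Prop. 3; Harvey1977, Lemma 1.8] -/
theorem setIntegral_extDeriv_apply_orientationFrame_eq_zero {A : Set Ω} {q : ℕ}
    (hA : HasPureDim 𝓘(ℂ, V) A (q + 1)) (ψ : TestForm Ω (2 * q + 1)) :
    ∫ x in (ofSet A hA).carrier, extDeriv ⇑ψ x ((ofSet A hA).orientationFrame x)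
      ∂(μHE[2 * q + 1 + 1] : Measure V) = 0 := by
  have h0 : (ofSet A hA).boundary ψ = 0 := by
    rw [Harvey1977_boundary_toCurrent_eq_zero_holds V Ω q (ofSet A hA)]
    rfl
  rw [boundary_apply_eq_setIntegral] at h0
  rw [← h0]
  refine setIntegral_congr_fun (ofSet A hA).measurableSet_carrier fun x hx => ?_
  simp only [density_ofSet_of_mem_carrier hA hx, Int.cast_one, one_mul]

end Opens

end HolomorphicChain

end Literature.Geometry.Kaehler
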